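import Mathlib.Analysis.SpecialFunctions.OrdinaryHypergeometric
import Mathlib.MeasureTheory.Integral.IntervalIntegral.Basic
import Literature.Probability.RandomPlanarGeometry.SelfAvoidingWalk
import Literature.Probability.LatticeModels.SRWPathSpace
import HarnessLib

/-!
# The SAW × random-walk-excursion non-intersection observable and its Cardy–Fomin target function

Topic `Probability/RandomPlanarGeometry`; namespace `Literature.Probability.RandomPlanarGeometry`.
Definition request `defn-SAWExcursionAvoidanceObservable` of route
`Summits/CriticalPhenomena/SAWScalingLimit/Theses/SAWExcursionCardy` (items
stmt-CriticalPhenomena-4511 ff. carry these objects as inline `let`s; this file names them, with the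
SAME bodies, so that the planned restatement over them is definitional).

Objects (the route's own; the discrete-excursion vocabulary is Kozdron's, *The scaling limit of
Fomin's identity for two paths in the plane* (2007), §2, read on `paper:arxiv-math_0703615`: "let the
discrete excursion Poisson kernel `h_{∂A}(x, y)` be the probability that a simple random walk starting
at `x` takes its first step into `A` and then leaves `A` at `y`"; the SAW side is the critical
square-lattice SAW law `SAW.law` of `SelfAvoidingWalk.lean`, Lawler–Schramm–Werner 2004 §3):

* `SRWExcursion.exitAfterAvoiding Gr p q A` — for a subgraph `Gr` of `ℤ²` (in the route:
  `Gr = discreteDomainGraph Ω δ`), the `SRW.pathLaw`-probability that the simple random walk started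
  at `p` follows edges of `Gr` for `n` steps, stands at `q` at time `n`, makes a NON-`Gr` step at time
  `n + 1` (it is killed right after `q`), and avoids the set `A` at all times `≤ n` — the excursion
  functional `E` of the route (token-for-token its inline `let E`);
* `SRWExcursion.killedGreen Gr p q = ∑_n P[walk follows Gr-edges for n steps and S_n = q - p]` — the
  Green function of the walk killed at its first non-`Gr` step (inline `let Gf` of the route);
* `SRWExcursion.avoidRatio Gr p q A = E(A)/E(∅)` (the route's `h_S`);
* `SAW.excursionAvoidance Ω δ a b c d = ∫ E(vertices of γ)/E(∅) dSAW.law(γ)` — the probability that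
  the critical SAW of `Ω_δ` from `a` to `b` and an independent excursion of `Ω_δ` from `c` to `d`
  (killed right after `d`) are vertex-disjoint (the route's `N_δ`), and its conditional version
  `SAW.condExcursionAvoidance … η` given a SAW prefix `η` from `a` to a tip `v` (the route's
  `condAvoid`: average over `{γ extends η}`);
* `sawExcursionF u = (8/5) u ₂F₁(-1/2, 2; 7/2; u)` (Mathlib `ordinaryHypergeometric`, notation `₂F₁`)
  — the target function (route items `CardyFSpec`, `ExcursionCardyFormula`; the `κ = 8/3` member of
  the family whose `κ = 2` member is Kozdron's `u(2 - u)`, op. cit. §6, Thm. 6.1 and the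
  hypergeometric reduction following it), and `sawExcursionFIntegrand`, the Euler integrand
  `t √((1-t)(1-ut))` of its integral form `F(u) = 6u ∫₀¹ t√((1-t)(1-ut)) dt` (the identity itself is
  item `CardyFSpec`, not claimed here).

Proved API: monotonicity and `[0,1]`-bounds of `E` in the avoided set (`exitAfterAvoiding_anti`,
`_nonneg`, `_le_one`), `avoidRatio_empty`, `avoidRatio ∈ [0,1]`, `excursionAvoidance_nonneg`,
`sawExcursionF_zero`, `sawExcursionFIntegrand` non-negativity on the unit square. NOT here (they are
statement items / provable supports of the route, not definitions): the domain-Markov factorisation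
`N(η) = h_S(η) · Ñ(Ω_δ ∖ (η ∖ tip))`, the martingale property of `n ↦ P[ω ∩ γ = ∅ | γ[0,n]]`, the
reversal symmetries, `F(1) = 1` (Gauss summation) and the Euler integral. Mathlib has `₂F₁`
(`ordinaryHypergeometric`), interval integrals and `Measure.real`; no SAW or excursion objects.

## References

* M. J. Kozdron, *The scaling limit of Fomin's identity for two paths in the plane*, C. R. Math.
  Acad. Sci. Soc. R. Can. 29 (2007) 65–80, §2 (discrete excursions, `h_{∂A}`), §6 Thm. 6.1.
  [Kozdron2007Fomin]
* S. Fomin, *Loop-erased walks and total positivity*, Trans. AMS 353 (2001). [Fomin2001]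
* G. F. Lawler, O. Schramm, W. Werner, *On the scaling limit of planar self-avoiding walk*, in:
  Fractal geometry and applications, Proc. Sympos. Pure Math. 72 (2004), §3. [LawlerSchrammWerner2004SAW]
-/

noncomputable section

open MeasureTheory Set Literature.Probability.LatticeModels
open scoped ENNReal

namespace Literature.Probability.RandomPlanarGeometry

/-! ### The random-walk excursion functional -/

namespace SRWExcursion

/-- **The excursion functional `E_Gr(p, q; A)`**: the probability (under the simple-random-walk law
`SRW.pathLaw 2`, positions `p + S_j`) that for some `n` the walk follows edges of the subgraph `Gr`
of `ℤ²` at all times `j < n`, its step at time `n` is NOT a `Gr`-edge (the walk run on `Gr` and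
killed at its first non-`Gr` step dies right after time `n`), it stands at `q` at time `n`, and it
avoids `A` at all times `j ≤ n`. For `Gr = Ω_δ` and boundary vertices `p = c`, `q = d` this is the
mass of excursions of `Ω_δ` from `c` to `d` avoiding `A` (Kozdron 2007, §2: discrete excursion
Poisson kernel, here in the killed-walk normalisation of route `SAWExcursionCardy`, whose inline
`let E` this is verbatim). [cite: Kozdron2007Fomin, §2] -/
def exitAfterAvoiding (Gr : SimpleGraph (Site 2)) (p q : Site 2) (A : Set (Site 2)) : ℝ :=
  (SRW.pathLaw 2).real {ω | ∃ n : ℕ, (∀ j < n, Gr.Adj (p + SRW.S ω j) (p + SRW.S ω (j + 1))) ∧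
    ¬ Gr.Adj (p + SRW.S ω n) (p + SRW.S ω (n + 1)) ∧ p + SRW.S ω n = q ∧ ∀ j ≤ n, p + SRW.S ω j ∉ A}

/-- **The killed Green function** `G_Gr(p, q) = ∑_n P[S follows Gr-edges for n steps, p + S_n = q]`:
expected number of visits to `q` of the walk from `p` run on `Gr` and killed at its first non-`Gr`
step (inline `let Gf` of route items `SlitExcursionCardy`, `RWGreenCrossRatioLimit`).
[cite: KozdronLawler2005, §1] -/
def killedGreen (Gr : SimpleGraph (Site 2)) (p q : Site 2) : ℝ :=
  ∑' n : ℕ, (SRW.pathLaw 2).real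
    {ω | (∀ j < n, Gr.Adj (p + SRW.S ω j) (p + SRW.S ω (j + 1))) ∧ p + SRW.S ω n = q}

/-- **The avoidance ratio `h_A = E(A)/E(∅)`**: the conditional probability that the excursion from
`p` to `q` avoids `A` (the route's `h_S`; junk `0` when `E(∅) = 0`). [cite: Kozdron2007Fomin, §2] -/
def avoidRatio (Gr : SimpleGraph (Site 2)) (p q : Site 2) (A : Set (Site 2)) : ℝ :=
  exitAfterAvoiding Gr p q A / exitAfterAvoiding Gr p q ∅

variable (Gr : SimpleGraph (Site 2)) (p q : Site 2)

/-- Enlarging the avoided set shrinks the event: `A ⊆ B → E(B) ≤ E(A)`. [folklore] -/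
theorem exitAfterAvoiding_anti {A B : Set (Site 2)} (h : A ⊆ B) :
    exitAfterAvoiding Gr p q B ≤ exitAfterAvoiding Gr p q A := by
  refine measureReal_mono ?_
  rintro ω ⟨n, h1, h2, h3, h4⟩
  exact ⟨n, h1, h2, h3, fun j hj hA => h4 j hj (h hA)⟩

/-- `0 ≤ E(A)`. [folklore] -/
theorem exitAfterAvoiding_nonneg (A : Set (Site 2)) : 0 ≤ exitAfterAvoiding Gr p q A :=
  measureReal_nonneg

/-- `E(A) ≤ 1` (a probability). [folklore] -/
theorem exitAfterAvoiding_le_one (A : Set (Site 2)) : exitAfterAvoiding Gr p q A ≤ 1 :=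
  measureReal_le_one

/-- `E(A) ≤ E(∅)`. [folklore] -/
theorem exitAfterAvoiding_le_empty (A : Set (Site 2)) :
    exitAfterAvoiding Gr p q A ≤ exitAfterAvoiding Gr p q ∅ :=
  exitAfterAvoiding_anti Gr p q (empty_subset A)

/-- `h_∅ = 1` as soon as excursions from `p` to `q` exist (`E(∅) ≠ 0`). [folklore] -/
theorem avoidRatio_empty (h : exitAfterAvoiding Gr p q ∅ ≠ 0) : avoidRatio Gr p q ∅ = 1 :=
  div_self h

/-- `0 ≤ h_A`. [folklore] -/
theorem avoidRatio_nonneg (A : Set (Site 2)) : 0 ≤ avoidRatio Gr p q A :=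
  div_nonneg (exitAfterAvoiding_nonneg Gr p q A) (exitAfterAvoiding_nonneg Gr p q ∅)

/-- `h_A ≤ 1`. [folklore] -/
theorem avoidRatio_le_one (A : Set (Site 2)) : avoidRatio Gr p q A ≤ 1 :=
  div_le_one_of_le₀ (exitAfterAvoiding_le_empty Gr p q A) (exitAfterAvoiding_nonneg Gr p q ∅)

/-- `h` is antitone in the avoided set. [folklore] -/
theorem avoidRatio_anti {A B : Set (Site 2)} (h : A ⊆ B) :
    avoidRatio Gr p q B ≤ avoidRatio Gr p q A :=
  div_le_div_of_nonneg_right (exitAfterAvoiding_anti Gr p q h) (exitAfterAvoiding_nonneg Gr p q ∅)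

end SRWExcursion

/-! ### The SAW × excursion non-intersection observable -/

namespace SAW

/-- **The non-intersection observable `N_δ(Ω; a, b; c, d)`**: the probability that the critical SAW
`γ` of `Ω_δ` from `a` to `b` (law `SAW.law Ω δ a b`, weight `x_c^{|γ|}`) and an independent
simple-random-walk excursion of `Ω_δ` from `c` to `d`, killed right after `d`, are vertex-disjoint:
`N_δ = ∫ E(vertices of γ)/E(∅) dSAW.law(γ)` with `E = SRWExcursion.exitAfterAvoiding (Ω_δ) c d`
(route `SAWExcursionCardy`, inline `let N` of `ExcursionCardyFormula`, verbatim after unfolding `E`;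
the SAW analogue of the left side of Fomin's identity / Kozdron 2007 Thm. 6.1).
[cite: Kozdron2007Fomin, §6 Thm. 6.1] -/
def excursionAvoidance (Ω : Set ℂ) (δ : ℝ) (a b c d : Site 2) : ℝ :=
  ∫ γ, SRWExcursion.exitAfterAvoiding (discreteDomainGraph Ω δ) c d {v | v ∈ γ.walk.support} /
      SRWExcursion.exitAfterAvoiding (discreteDomainGraph Ω δ) c d ∅ ∂(SAW.law Ω δ a b)

/-- The integrand of `N_δ` is the avoidance ratio of the vertex set of the SAW. [folklore] -/
theorem excursionAvoidance_eq_integral_avoidRatio (Ω : Set ℂ) (δ : ℝ) (a b c d : Site 2) :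
    excursionAvoidance Ω δ a b c d =
      ∫ γ, SRWExcursion.avoidRatio (discreteDomainGraph Ω δ) c d {v | v ∈ γ.walk.support}
        ∂(SAW.law Ω δ a b) :=
  rfl

/-- `0 ≤ N_δ`. [folklore] -/
theorem excursionAvoidance_nonneg (Ω : Set ℂ) (δ : ℝ) (a b c d : Site 2) :
    0 ≤ excursionAvoidance Ω δ a b c d :=
  integral_nonneg fun _ => SRWExcursion.avoidRatio_nonneg _ _ _ _

/-- **The conditional non-intersection observable given a SAW prefix.** For a walk `η` of `Ω_δ` from
`a` to a tip `v`, `N_δ(η)` = the `SAW.law`-average of `E(vertices of γ)` over the event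
`X = {γ : γ extends η}`, divided by `SAW.law(X)` and by `E(∅)` — the route's `condAvoid` of item
`SlitExcursionCardy` (verbatim after unfolding `E`); junk `0` when `SAW.law(X) = 0` or `E(∅) = 0`.
[cite: Kozdron2007Fomin, §6 (proof of Thm. 6.1: conditioning on the path up to time t)] -/
def condExcursionAvoidance (Ω : Set ℂ) (δ : ℝ) (a b c d : Site 2) {v : Site 2}
    (η : (discreteDomainGraph Ω δ).Walk a v) : ℝ :=
  let G := discreteDomainGraph Ω δ
  let X : Set (DomainSAW Ω δ a b) := {γ | ∃ q : G.Walk v b, γ.walk = η.append q}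
  (∫ γ in X, SRWExcursion.exitAfterAvoiding G c d {w | w ∈ γ.walk.support} ∂(SAW.law Ω δ a b)) /
    (SAW.law Ω δ a b).real X / SRWExcursion.exitAfterAvoiding G c d ∅

/-- With the empty prefix the conditioning event is everything: `N_δ(nil) = (∫ E(γ) dSAW.law) /
SAW.law(univ) / E(∅)` (so `= N_δ` whenever `SAW.law` is a probability measure). [folklore] -/
theorem condExcursionAvoidance_nil (Ω : Set ℂ) (δ : ℝ) (a b c d : Site 2) :
    condExcursionAvoidance Ω δ a b c d (SimpleGraph.Walk.nil : (discreteDomainGraph Ω δ).Walk a a) =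
      (∫ γ, SRWExcursion.exitAfterAvoiding (discreteDomainGraph Ω δ) c d {w | w ∈ γ.walk.support}
          ∂(SAW.law Ω δ a b)) / (SAW.law Ω δ a b).real univ /
        SRWExcursion.exitAfterAvoiding (discreteDomainGraph Ω δ) c d ∅ := by
  have hX : {γ : DomainSAW Ω δ a b | ∃ q : (discreteDomainGraph Ω δ).Walk a b,
      γ.walk = (SimpleGraph.Walk.nil : (discreteDomainGraph Ω δ).Walk a a).append q} = univ :=
    eq_univ_of_forall fun γ => ⟨γ.walk, by simp⟩
  simp only [condExcursionAvoidance, hX, Measure.restrict_univ]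

end SAW

/-! ### The target function `F(u) = (8/5) u ₂F₁(-1/2, 2; 7/2; u)` -/

/-- **The Cardy–Fomin target function of the SAW × excursion observable**:
`F(u) = (8/5) · u · ₂F₁(-1/2, 2; 7/2; u)` (Mathlib `ordinaryHypergeometric`), the `κ = 8/3`
member (`a = 1 - 4/κ = -1/2`, `b = 2`, `c = 2 + 4/κ = 7/2`) of the family of bounded solutions of
the hypergeometric equations whose `κ = 2` member is Kozdron's `φ(u) = u(2 - u)` (Kozdron 2007, §6,
the reduction to "a well-known hypergeometric differential equation"); normalised by `F(1) = 1`
(Gauss: `₂F₁(-1/2, 2; 7/2; 1) = 5/8`, item `CardyFSpec`, not proved here). Verbatim the inline `let F`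
of route items `ExcursionCardyFormula`, `SlitExcursionCardy`, `CardyFSpec`.
[cite: Kozdron2007Fomin, §6] -/
def sawExcursionF (u : ℝ) : ℝ :=
  (8 / 5 : ℝ) * u * ₂F₁ (-1 / 2 : ℝ) (2 : ℝ) (7 / 2 : ℝ) u

/-- `F(0) = 0`. [folklore] -/
@[simp] theorem sawExcursionF_zero : sawExcursionF 0 = 0 := by
  simp [sawExcursionF]

/-- Unfolding `F` (the form carried inline by the route items). [folklore] -/
theorem sawExcursionF_eq (u : ℝ) :
    sawExcursionF u = (8 / 5 : ℝ) * u * ₂F₁ (-1 / 2 : ℝ) (2 : ℝ) (7 / 2 : ℝ) u := rfl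

/-- The Euler integrand `t √((1 - t)(1 - u t))` of the integral form
`F(u) = 6 u ∫₀¹ t √((1 - t)(1 - u t)) dt` (item `CardyFSpec`; Euler's integral representation of
`₂F₁(-1/2, 2; 7/2; u)` with `B(2, 3/2) = 4/15`). [folklore] -/
def sawExcursionFIntegrand (u t : ℝ) : ℝ :=
  t * Real.sqrt ((1 - t) * (1 - u * t))

/-- The Euler integrand is non-negative for `t ≥ 0`. [folklore] -/
theorem sawExcursionFIntegrand_nonneg {u t : ℝ} (ht : 0 ≤ t) : 0 ≤ sawExcursionFIntegrand u t :=
  mul_nonneg ht (Real.sqrt_nonneg _)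

/-- At `t = 0` and `t = 1` the Euler integrand vanishes. [folklore] -/
@[simp] theorem sawExcursionFIntegrand_zero_one (u : ℝ) :
    sawExcursionFIntegrand u 0 = 0 ∧ sawExcursionFIntegrand u 1 = 0 := by
  simp [sawExcursionFIntegrand]

/-- The Euler integral `6 u ∫₀¹ t √((1 - t)(1 - u t)) dt` is non-negative for `u ≥ 0`. [folklore] -/
theorem sawExcursionF_euler_nonneg {u : ℝ} (hu : 0 ≤ u) :
    0 ≤ 6 * u * ∫ t in (0 : ℝ)..1, sawExcursionFIntegrand u t := by
  refine mul_nonneg (by positivity) ?_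
  exact intervalIntegral.integral_nonneg zero_le_one fun t ht => sawExcursionFIntegrand_nonneg ht.1

end Literature.Probability.RandomPlanarGeometry

end
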